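import Literature.MathematicalPhysics.QuantumFieldTheory.Balaban1985CMP102.SectA
import Literature.MathematicalPhysics.QuantumFieldTheory.Balaban1983to89.B7BlockAvgLog

/-!
# `Summit.QuantumFields.Balaban3D.Proofs.SectAEq16` — [Balaban1985UV3] **(16)** p. 259 (the δ-function change of variables
# to the Lie algebra: the constraint «\overline{U′U₁}(c) = Ū₁(c)» of (13) is the constraint «Q(A′, c) = 0») DERIVED from
# the spine's **(14)** (`SectA.Eq14`) for the spine's statement `SectA.Eq16`, under the two side conditions print uses
# silently — lane `pub-balaban3d`, seat p4 (PLAN.md §3.4 «p4 ← (7)–(22)»)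

HONEST FRAMING (lane PLAN.md §0, binding): see `…Proofs.SectAFirstStep`.  An elementary group-algebra step; nothing else of
[Balaban1985UV3] is touched.  The Jacobian half of (16) (the factor `1/σ₀` per coarse bond) is LQB's
`B10Eq22Rescaling.haar_density_split`/`sigma0_pow_bookkeeping` (PROVED there) and is not restated.

WHAT IS PRINTED.  p. 259 = PDF 5 L22–37 (render `…/1985-cmp102-uv-stability-3d/…-p005-x2.png`), verbatim: «For the
expressions in δ-functions defining the renormalization transformation we have  (\overline{U′U₁})(Ū₁)^{−1} = Ũ′ = U̿′ =
exp iQ(A′),  (14) … It is an analytic function of A′ with the decomposition  Q(A′) = QA′ + C(A′),  (15) … The δ-function in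
(13) can be written as  Π_{c∈Ω₁^{(1)}} δ((\overline{U′U₁})(c)(Ū₁(c))^{−1}) = Π_{c∈Ω₁^{(1)}} (1/σ₀) δ(Q(A′, c)),  (16)  where the
δ-functions on the right are defined on the vector space 𝔤, and concentrated at the origin of this space.»  The spine types
(14) as `Eq14 𝒞 : avg(e^{iA′}U₁)(c) = exp(iQ(A′,c))·avg(U₁)(c)` and the zero-set half of (16) as `Eq16 𝒞 :
avg(e^{iA′}U₁)(c) = avg(U₁)(c) ↔ Q(A′,c) = 0`, both for `A′` in the fluctuation domain `|A′(b)| < r`.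

WHAT THIS FILE PROVES (no `sorry`, axioms standard): `eq16_of_eq14 : Eq14 𝒞 → (∀ c, IsUnit (avg U₁ c)) → (∀ A′ small, ∀ c,
‖Q(A′, c)‖ < 1) → Eq16 𝒞`.  The two side conditions are the ones print uses without saying: (i) the averages `Ū₁(c)` are
group elements, hence invertible — print WRITES `(Ū₁(c))^{−1}` in (14)/(16) ([4] (15) p. 19: `Ū` takes values in G); (ii) on
the fluctuation domain `Q(A′, c)` is small, so that `exp(iQ) = 1` forces `Q = 0` — print: (15) with «C(A′) … beginning with
a second order polynomial» and the domain «|A′| < 16·3²L²B₃g₀p(g₀)» of (13) p. 259 L12 «for g₀ sufficiently small»; the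
injectivity itself is LQB's `B7BlockAvgLog.eq_zero_of_exp_eq_one` (`‖D‖ < 1`, `e^D = 1 ⇒ D = 0`).  Both conditions are
dischargeable by the carrier seat for the concrete average; here they are explicit hypotheses (NOT-IN-PRINT as stated
conditions; located above).
-/

namespace Summit.QuantumFields.Balaban3D.Proofs.SectAEq16

open Literature.MathematicalPhysics.QuantumFieldTheory.Balaban1983to89
open Literature.MathematicalPhysics.QuantumFieldTheory.Balaban1985CMP102.SectA (AvgChart Eq14 Eq16)

variable {𝔸 : Type*} [NormedRing 𝔸] [NormedAlgebra ℂ 𝔸] [CompleteSpace 𝔸] {β C : Type*}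

/-- [folklore] `exp(iX) = 1` with `‖X‖ < 1` forces `X = 0` (LQB `B7BlockAvgLog.eq_zero_of_exp_eq_one` at `D = iX`,
`‖iX‖ = ‖X‖`). [folklore] -/
theorem eq_zero_of_exp_I_smul_eq_one {X : 𝔸} (hX : ‖X‖ < 1) (h : NormedSpace.exp (Complex.I • X) = 1) : X = 0 := by
  have hn : ‖Complex.I • X‖ < 1 := by rwa [norm_smul, Complex.norm_I, one_mul]
  have h0 := B7BlockAvgLog.eq_zero_of_exp_eq_one hn h
  exact (smul_eq_zero.mp h0).resolve_left Complex.I_ne_zero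

/-- **(16) p. 259 from (14)**, for the spine's statements: if `Eq14 𝒞` holds, every average `Ū₁(c)` is a unit (print writes
`(Ū₁(c))^{−1}`), and `‖Q(A′, c)‖ < 1` on the fluctuation domain, then `Eq16 𝒞`: the constraint `\overline{U′U₁}(c) = Ū₁(c)` of
the δ-function of (13) is equivalent to `Q(A′, c) = 0` — «the δ-functions on the right are defined on the vector space 𝔤,
and concentrated at the origin of this space».  Kernel-checked: cancel the unit, then injectivity of `exp` near 0.
[cite: Balaban1985UV3, (16) p.259] -/
theorem eq16_of_eq14 (𝒞 : AvgChart 𝔸 β C) (h14 : Eq14 𝒞) (hunit : ∀ c : C, IsUnit (𝒞.avg 𝒞.U₁ c))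
    (hQ : ∀ A' : β → 𝔸, (∀ b, ‖A' b‖ < 𝒞.r) → ∀ c : C, ‖𝒞.Q A' c‖ < 1) : Eq16 𝒞 := by
  intro A' hA' c
  have h := h14 A' hA' c
  constructor
  · intro heq
    rw [heq] at h
    have h1 : (1 : 𝔸) * 𝒞.avg 𝒞.U₁ c = NormedSpace.exp (Complex.I • 𝒞.Q A' c) * 𝒞.avg 𝒞.U₁ c := by
      rw [one_mul]; exact h
    have h2 : NormedSpace.exp (Complex.I • 𝒞.Q A' c) = 1 := ((hunit c).mul_left_inj.mp h1).symm
    exact eq_zero_of_exp_I_smul_eq_one (hQ A' hA' c) h2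
  · intro hzero
    rw [h, hzero, smul_zero, NormedSpace.exp_zero, one_mul]

end Summit.QuantumFields.Balaban3D.Proofs.SectAEq16
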